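import Summits.HodgeConjecture.HodgeConjecture.Theorems.Ring2WeilCoverageCMFieldNormResidueSymbolsDyadic
import HarnessLib

/-!
# Ring 2 — Weil-family coverage, CM-field rows: the `T`-set of a RATIONAL PRIME `ℓ` on Deligne's carriers — which
  places of `F` can carry `(ℓ, θ)_v = -1`, and the class `[ℓ]` read at ONE odd place
  (WEIL-FAMILY-COVERAGE «## b03», cell (xxi′), part 12)

research route conditional on HC_CM; not a corollary; Q11.4-sentence-2 already refuted in dim ≥ 3.

The rows `W_{2k}.E.δ` of the census over Deligne's carrier `R` (`F = ℚ[S]/(R) = ℚ(θ)`, `E = F(√θ)`,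
`δ ∈ F^×/Nm_{E/F}(E^×) = cmNormResidueGroup R`) are labelled by `T(q) = badPlaces q θ`, the finite even set of places
of `F` at which `(q, θ)_𝔭 = -1` [cite: Deligne1982HodgeCycles, §4: display (1), Prop. 4.1, Cor. 4.2]; parts 1–11 gave
the closed form of every membership.  The census column «primes `[ℓ] ≠ [1] ⟺ …`» of §b03.5 / §b03.29 concerns the
classes of the RATIONAL PRIMES `ℓ` (the integer rows `W_{2k}.E.[ℓ]`).  This file isolates, for every carrier and
after any square-class change `θ = c²·b` (`b ∈ 𝓞_F`, part 6 §10), WHICH places can lie in `T(ℓ)`: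

* §25 tools: `v`-units have `ord_v = 0`; coprime integers do not lie in a common prime; the classes of the norms
  `x² - b y²` are split (`mk_eq_splitDiscriminantClassCM_of_eq_sq_sub_mul_sq` — used for the finitely many primes
  dividing `2·b·disc` in the sequels).
* §26 the three kinds of places against `(ℓ, θ)_𝔭`: (a) at a finite `v ∤ 2b`:
  `v ∈ T(ℓ) ⟺ (b non-square mod v) ∧ ord_v ℓ odd` (O'Meara 63:11a/63:12, part 3/6), in particular `v ∣ ℓ`;
  (b) at a finite non-dyadic `v ∣ b` PRIME TO `ℓ` the symbol is `(b, ℓ)_v` against the unit `ℓ`, so `v ∉ T(ℓ)` as soon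
  as `ℓ` is a square mod `v` OR `ord_v b` is even; (c) no infinite place lies in `T(ℓ)` (`ℓ > 0`, part 2).
* §27 **THEOREM (the class of a rational prime is read at the odd places over `ℓ`)**: if `F` has at most ONE dyadic
  place and the non-dyadic places dividing `b` are prime to `ℓ` and harmless in the sense of (b), then
  **`T(ℓ) ≠ ∅ ⟺ ∃ v ∤ 2b : (b non-square mod v) ∧ ord_v ℓ odd`**, i.e. **`[ℓ] ≠ [(-1)^k]` (`k` even) iff some place
  `v ∣ ℓ`, `v ∤ 2b`, of odd ramification over `ℓ` is INERT in `E = F(√b)`** — the dyadic place never decides, by the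
  parity complement (Hilbert reciprocity 71:18, part 6 §12) [cite: Omeara1963, §71D Thm. 71:18].
The sequel `…RationalPrimesQuadratic` turns this, for the quadratic carriers `R = S² + pS + q` with a RATIONAL radicand
`b ∈ ℤ` (the biquadratic fields `E = F(√-c₀)` of §b03.5/§b03.29), into the Legendre-symbol rule
`[ℓ] ≠ [1] ⟺ (disc R | ℓ) = 1 ∧ (b | ℓ) = -1` («`ℓ` splits in `F` into two places inert in `E`»).
No new definition, no named fact, no sorry; nothing about the Hodge conjecture is asserted.
-/

noncomputable section

set_option linter.dupNamespace false

open Polynomial NumberField IsDedekindDomain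

namespace Summit.HodgeConjecture.HodgeConjecture.Ring2.WeilCoverageCM

open Literature.AlgebraicGeometry.Deligne1982
open Literature.AlgebraicGeometry.HodgeTheory (splitDiscriminantClassCM)
open Literature.NumberTheory.QuadraticForms

variable {R : Polynomial ℤ} [Fact (Irreducible (cmPolyQ R))] [Fact (Irreducible (realPolyQ R))]

/-! ### §25 Tools: units, coprime integers, norms -/

omit [Fact (Irreducible (cmPolyQ R))] in
/-- A `v`-unit `x ∈ 𝓞_F` has `ord_v x = 0`. [folklore] -/
theorem log_valuation_coe_eq_zero_of_notMem (v : HeightOneSpectrum (𝓞 (realField R))) {x : 𝓞 (realField R)}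
    (hx : x ∉ v.asIdeal) : WithZero.log (v.valuation (realField R) (x : realField R)) = 0 := by
  rw [show (x : realField R) = algebraMap (𝓞 (realField R)) (realField R) x from rfl,
    HeightOneSpectrum.valuation_of_algebraMap, HeightOneSpectrum.intValuation_eq_one_iff.2 hx, WithZero.log_one]

omit [Fact (Irreducible (cmPolyQ R))] in
/-- If `ord_v ℓ` is odd for a natural number `ℓ`, then `ℓ ∈ v`. [folklore] -/
theorem natCast_mem_of_odd_log_valuation (v : HeightOneSpectrum (𝓞 (realField R))) {ℓ : ℕ}
    (h : Odd (WithZero.log (v.valuation (realField R) (ℓ : realField R)))) : (ℓ : 𝓞 (realField R)) ∈ v.asIdeal := by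
  by_contra hn
  have h0 := log_valuation_coe_eq_zero_of_notMem v hn
  have e : ((ℓ : 𝓞 (realField R)) : realField R) = (ℓ : realField R) :=
    map_natCast (algebraMap (𝓞 (realField R)) (realField R)) ℓ
  rw [e] at h0
  rw [h0] at h
  exact (Int.not_odd_iff_even.2 (by decide)) h

omit [Fact (Irreducible (cmPolyQ R))] in
/-- **Two coprime integers do not lie in a common prime of `𝓞_F`** (`u a + w b = 1`). [folklore] -/
theorem intCast_notMem_of_isCoprime (v : HeightOneSpectrum (𝓞 (realField R))) {a b : ℤ} (hab : IsCoprime a b)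
    (ha : (a : 𝓞 (realField R)) ∈ v.asIdeal) : (b : 𝓞 (realField R)) ∉ v.asIdeal := by
  intro hb
  obtain ⟨u, w, h⟩ := hab
  refine v.isPrime.ne_top ((Ideal.eq_top_iff_one _).2 ?_)
  have h1 : ((u * a + w * b : ℤ) : 𝓞 (realField R)) = 1 := by rw [h, Int.cast_one]
  rw [← h1]
  push_cast
  exact v.asIdeal.add_mem (v.asIdeal.mul_mem_left _ ha) (v.asIdeal.mul_mem_left _ hb)

/-- **Norms are split**: if `θ = c²·b` and `q = x² - b·y²` (`x, y ∈ F`), then `[q]` is the split class `[(-1)^k]`,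
`k` even (`q = x² - θ(y/c)² ∈ Nm_{E/F}(E^×)`, Deligne Cor. 4.2). Used for the finitely many primes `ℓ ∣ 2·b·disc`
of the census tables, e.g. `c₀ = 0² - (-c₀)·1²`. [cite: Deligne1982HodgeCycles, §4 Cor. 4.2]
[cite: Omeara1963, §63B 63:10] -/
theorem mk_eq_splitDiscriminantClassCM_of_eq_sq_sub_mul_sq {c b : realField R}
    (hfac : AdjoinRoot.root (realPolyQ R) = c ^ 2 * b) (q : (realField R)ˣ) {x y : realField R}
    (h : (q : realField R) = x ^ 2 - b * y ^ 2) {k : ℕ} (hk : Even k) :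
    (QuotientGroup.mk q : cmNormResidueGroup R) = splitDiscriminantClassCM R k := by
  rw [splitDiscriminantClassCM, hk.neg_one_pow, eq_comm, mk_eq_mk_iff_mem_quadraticNormSubgroup, inv_one, one_mul,
    mem_quadraticNormSubgroup_iff]
  have hc := ne_zero_of_root_eq_sq_mul hfac
  exact ⟨x, y / c, by rw [h, hfac]; field_simp⟩

/-! ### §26 The three kinds of places against `(ℓ, θ)_𝔭`, `ℓ` a rational prime -/

/-- **(a) A finite place `v ∤ 2b`** (`θ = c²·b`): `v ∈ T(ℓ) ⟺ (b` is a non-square mod `v) ∧ ord_v ℓ` odd.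
[cite: Omeara1963, §63B Cor. 63:11a and Example 63:12] [cite: Deligne1982HodgeCycles, §4 (1)] -/
theorem inl_mem_badPlaces_natCast_iff_of_notMem {c : realField R} {b : 𝓞 (realField R)}
    (hfac : AdjoinRoot.root (realPolyQ R) = c ^ 2 * (b : realField R)) (v : HeightOneSpectrum (𝓞 (realField R)))
    (h2 : (2 : 𝓞 (realField R)) ∉ v.asIdeal) (hbv : b ∉ v.asIdeal) {ℓ : ℕ} (hℓ : ℓ.Prime) :
    Sum.inl v ∈ badPlaces (ℓ : realField R) (AdjoinRoot.root (realPolyQ R)) ↔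
      ¬ IsSquare (Ideal.Quotient.mk v.asIdeal b) ∧
        Odd (WithZero.log (v.valuation (realField R) (ℓ : realField R))) := by
  rw [mem_badPlaces_iff, placeSymbol_inl,
    hilbertSymbol_adicCompletion_root_eq_neg_one_iff_of_eq_sq_mul_of_notMem hfac v h2 hbv
      (show (ℓ : realField R) ≠ 0 by exact_mod_cast hℓ.ne_zero)]

/-- Hence a finite place `v ∤ 2b` in `T(ℓ)` DIVIDES `ℓ`. [cite: Omeara1963, §63B Example 63:12] -/
theorem natCast_mem_of_inl_mem_badPlaces {c : realField R} {b : 𝓞 (realField R)}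
    (hfac : AdjoinRoot.root (realPolyQ R) = c ^ 2 * (b : realField R)) (v : HeightOneSpectrum (𝓞 (realField R)))
    (h2 : (2 : 𝓞 (realField R)) ∉ v.asIdeal) (hbv : b ∉ v.asIdeal) {ℓ : ℕ} (hℓ : ℓ.Prime)
    (h : Sum.inl v ∈ badPlaces (ℓ : realField R) (AdjoinRoot.root (realPolyQ R))) :
    (ℓ : 𝓞 (realField R)) ∈ v.asIdeal :=
  natCast_mem_of_odd_log_valuation v ((inl_mem_badPlaces_natCast_iff_of_notMem hfac v h2 hbv hℓ).1 h).2

/-- **(b) A finite non-dyadic place `v ∣ b` PRIME TO `ℓ`**: there `(ℓ, θ)_v = (b, ℓ)_v` is the symbol of `b` against the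
`v`-UNIT `ℓ`, which is `-1` iff `ℓ` is a non-square mod `v` and `ord_v b` is odd (O'Meara 63:11a); so `v ∉ T(ℓ)` as
soon as `ℓ` is a square mod `v` (e.g. `v` of even residue degree) or `ord_v b` is even (e.g. `b ∈ ℤ` squarefree at a
prime ramified in `F`). [cite: Omeara1963, §63B Cor. 63:11a and Example 63:12] -/
theorem inl_notMem_badPlaces_natCast_of_mem {c : realField R} {b : 𝓞 (realField R)}
    (hfac : AdjoinRoot.root (realPolyQ R) = c ^ 2 * (b : realField R)) (v : HeightOneSpectrum (𝓞 (realField R)))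
    (h2 : (2 : 𝓞 (realField R)) ∉ v.asIdeal) {ℓ : ℕ} (hℓv : (ℓ : 𝓞 (realField R)) ∉ v.asIdeal)
    (h : IsSquare (Ideal.Quotient.mk v.asIdeal (ℓ : 𝓞 (realField R))) ∨
      ¬ Odd (WithZero.log (v.valuation (realField R) (b : realField R)))) :
    Sum.inl v ∉ badPlaces (ℓ : realField R) (AdjoinRoot.root (realPolyQ R)) := by
  have hb0 : (b : realField R) ≠ 0 := right_ne_zero_of_root_eq_sq_mul hfac
  rw [mem_badPlaces_iff, placeSymbol_inl, hilbertSymbol_adicCompletion_root_eq_of_eq_sq_mul hfac v, hilbertSymbol_comm]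
  have hℓ' : algebraMap (realField R) (v.adicCompletion (realField R)) (ℓ : realField R) =
      algebraMap (𝓞 (realField R)) (v.adicCompletion (realField R)) (ℓ : 𝓞 (realField R)) := by
    rw [IsScalarTower.algebraMap_apply (𝓞 (realField R)) (realField R) (v.adicCompletion (realField R)), map_natCast,
      map_natCast, map_natCast]
  have hb' : algebraMap (𝓞 (realField R)) (v.adicCompletion (realField R)) b =
      algebraMap (realField R) (v.adicCompletion (realField R)) (b : realField R) :=
    IsScalarTower.algebraMap_apply (𝓞 (realField R)) (realField R) (v.adicCompletion (realField R)) b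
  have hbne : algebraMap (𝓞 (realField R)) (v.adicCompletion (realField R)) b ≠ 0 := by
    rw [hb']; exact (_root_.map_ne_zero _).2 hb0
  rw [hℓ', hilbertSymbol_eq_neg_one_iff_not_isSquare_and_odd (realField R) v h2 hℓv hbne]
  have e1 : IsSquare (algebraMap (𝓞 (realField R)) (v.adicCompletion (realField R)) (ℓ : 𝓞 (realField R))) ↔
      IsSquare (Ideal.Quotient.mk v.asIdeal (ℓ : 𝓞 (realField R))) :=
    isSquare_algebraMap_adicCompletion_iff (realField R) v h2 hℓv
  have e2 : Valued.v (algebraMap (𝓞 (realField R)) (v.adicCompletion (realField R)) b) =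
      v.valuation (realField R) (b : realField R) := by
    rw [hb']; exact HeightOneSpectrum.valuedAdicCompletion_eq_valuation' v (b : realField R)
  rintro ⟨hns, hodd⟩
  rw [e2] at hodd
  rcases h with hsq | hev
  · exact hns (e1.2 hsq)
  · exact hev hodd

omit [Fact (Irreducible (cmPolyQ R))] in
/-- **(c) No infinite place lies in `T(ℓ)`**: `ℓ > 0` at every real embedding (part 2, roots of `R` real negative).
[cite: Deligne1982HodgeCycles, §4 (1)] [cite: Omeara1963, §63B] -/
theorem inr_notMem_badPlaces_natCast
    (hR : ∀ s : ℂ, Polynomial.eval₂ (Int.castRingHom ℂ) s R = 0 → s.im = 0 ∧ s.re < 0)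
    (w : InfinitePlace (realField R)) {ℓ : ℕ} (hℓ : ℓ.Prime) :
    Sum.inr w ∉ badPlaces (ℓ : realField R) (AdjoinRoot.root (realPolyQ R)) := by
  intro h
  have hpos : ∀ φ : realField R →+* ℝ, 0 < φ (ℓ : realField R) := fun φ ↦ by
    rw [map_natCast]; exact_mod_cast hℓ.pos
  obtain ⟨v, hv⟩ := (badPlaces_subset_range_inl_iff_totallyPositive hR (ℓ : realField R)).2 hpos h
  exact Sum.inl_ne_inr hv

/-! ### §27 The class of a rational prime is read at the odd places over `ℓ` -/

/-- **THEOREM (which places carry `(ℓ, θ)_v = -1`).** Let `θ = c²·b`, `b ∈ 𝓞_F`; assume `F` has at most ONE dyadic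
place, and that every non-dyadic place `v ∣ b` is prime to `ℓ` with `ℓ` a square mod `v` or `ord_v b` even. Then
**`T(ℓ) ≠ ∅ ⟺ ∃ v ∤ 2b` with `b` a non-square mod `v` and `ord_v ℓ` odd** (such a `v` divides `ℓ`): the places of
§26 (b), (c) never lie in `T(ℓ)`, and the dyadic place cannot be the only member of the even set `T(ℓ)` (Hilbert
reciprocity, part 6 §12). [cite: Omeara1963, §71D Thm. 71:18] [cite: Deligne1982HodgeCycles, §4 (1) and Cor. 4.2] -/
theorem badPlaces_natCast_nonempty_iff
    (hR : ∀ s : ℂ, Polynomial.eval₂ (Int.castRingHom ℂ) s R = 0 → s.im = 0 ∧ s.re < 0)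
    {c : realField R} {b : 𝓞 (realField R)} (hfac : AdjoinRoot.root (realPolyQ R) = c ^ 2 * (b : realField R))
    (huniq : ∀ v v' : HeightOneSpectrum (𝓞 (realField R)),
      (2 : 𝓞 (realField R)) ∈ v.asIdeal → (2 : 𝓞 (realField R)) ∈ v'.asIdeal → v = v')
    {ℓ : ℕ} (hℓ : ℓ.Prime)
    (hb : ∀ v : HeightOneSpectrum (𝓞 (realField R)), (2 : 𝓞 (realField R)) ∉ v.asIdeal → b ∈ v.asIdeal →
      (ℓ : 𝓞 (realField R)) ∉ v.asIdeal ∧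
        (IsSquare (Ideal.Quotient.mk v.asIdeal (ℓ : 𝓞 (realField R))) ∨
          ¬ Odd (WithZero.log (v.valuation (realField R) (b : realField R)))))  :
    (badPlaces (ℓ : realField R) (AdjoinRoot.root (realPolyQ R))).Nonempty ↔
      ∃ v : HeightOneSpectrum (𝓞 (realField R)), (2 : 𝓞 (realField R)) ∉ v.asIdeal ∧ b ∉ v.asIdeal ∧
        ¬ IsSquare (Ideal.Quotient.mk v.asIdeal b) ∧
          Odd (WithZero.log (v.valuation (realField R) (ℓ : realField R))) := by
  -- a bad place which is not dyadic yields the witness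
  have key : ∀ p ∈ badPlaces (ℓ : realField R) (AdjoinRoot.root (realPolyQ R)),
      (∀ v : HeightOneSpectrum (𝓞 (realField R)), p = Sum.inl v → (2 : 𝓞 (realField R)) ∉ v.asIdeal) →
        ∃ v : HeightOneSpectrum (𝓞 (realField R)), (2 : 𝓞 (realField R)) ∉ v.asIdeal ∧ b ∉ v.asIdeal ∧
          ¬ IsSquare (Ideal.Quotient.mk v.asIdeal b) ∧
            Odd (WithZero.log (v.valuation (realField R) (ℓ : realField R))) := by
    rintro (v | w) hp hnd
    · have h2 := hnd v rfl
      by_cases hbv : b ∈ v.asIdeal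
      · exact absurd hp (inl_notMem_badPlaces_natCast_of_mem hfac v h2 (hb v h2 hbv).1 (hb v h2 hbv).2)
      · exact ⟨v, h2, hbv, (inl_mem_badPlaces_natCast_iff_of_notMem hfac v h2 hbv hℓ).1 hp⟩
    · exact absurd hp (inr_notMem_badPlaces_natCast hR w hℓ)
  constructor
  · rintro ⟨p, hp⟩
    by_cases hnd : ∀ v : HeightOneSpectrum (𝓞 (realField R)), p = Sum.inl v → (2 : 𝓞 (realField R)) ∉ v.asIdeal
    · exact key p hp hnd
    · push Not at hnd
      obtain ⟨v₂, rfl, h2⟩ := hnd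
      -- the dyadic place is bad: by parity some OTHER place is bad, and it is not dyadic
      have hℓ0 : (ℓ : realField R) ≠ 0 := by exact_mod_cast hℓ.ne_zero
      have hpar := (mem_badPlaces_iff_odd_ncard_diff_singleton (R := R) (Units.mk0 (ℓ : realField R) hℓ0)
        (Sum.inl v₂)).1 (by rwa [Units.val_mk0])
      rw [Units.val_mk0] at hpar
      have hne : (badPlaces (ℓ : realField R) (AdjoinRoot.root (realPolyQ R)) \ {Sum.inl v₂}).Nonempty := by
        by_contra hempty
        rw [Set.not_nonempty_iff_eq_empty] at hempty
        rw [hempty, Set.ncard_empty] at hpar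
        exact (Nat.not_odd_iff_even.2 (by decide)) hpar
      obtain ⟨p₁, hp₁, hp₁ne⟩ := hne
      refine key p₁ hp₁ fun v hv h2v ↦ hp₁ne ?_
      rw [Set.mem_singleton_iff, hv, huniq v v₂ h2v h2]
  · rintro ⟨v, h2, hbv, hns, hodd⟩
    exact ⟨Sum.inl v, (inl_mem_badPlaces_natCast_iff_of_notMem hfac v h2 hbv hℓ).2 ⟨hns, hodd⟩⟩

/-- **THEOREM (the class of a rational prime, read at one odd place).** Under the hypotheses of
`badPlaces_natCast_nonempty_iff`: **`[ℓ] ≠ [(-1)^k]` (`k` even, the split class) iff some finite place `v ∤ 2b` of `F`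
has `b` a non-square mod `v` and `ord_v ℓ` odd** — i.e. iff some place over `ℓ`, prime to `2b` and of odd
ramification over `ℓ`, is INERT in `E = F(√b) = F(√θ)`. [cite: Deligne1982HodgeCycles, §4 (1) and Cor. 4.2]
[cite: Omeara1963, §63B Example 63:12 and §71D Thm. 71:18] -/
theorem mk_natCast_ne_splitDiscriminantClassCM_iff
    (hR : ∀ s : ℂ, Polynomial.eval₂ (Int.castRingHom ℂ) s R = 0 → s.im = 0 ∧ s.re < 0)
    {c : realField R} {b : 𝓞 (realField R)} (hfac : AdjoinRoot.root (realPolyQ R) = c ^ 2 * (b : realField R))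
    (huniq : ∀ v v' : HeightOneSpectrum (𝓞 (realField R)),
      (2 : 𝓞 (realField R)) ∈ v.asIdeal → (2 : 𝓞 (realField R)) ∈ v'.asIdeal → v = v')
    {ℓ : ℕ} (hℓ : ℓ.Prime)
    (hb : ∀ v : HeightOneSpectrum (𝓞 (realField R)), (2 : 𝓞 (realField R)) ∉ v.asIdeal → b ∈ v.asIdeal →
      (ℓ : 𝓞 (realField R)) ∉ v.asIdeal ∧
        (IsSquare (Ideal.Quotient.mk v.asIdeal (ℓ : 𝓞 (realField R))) ∨
          ¬ Odd (WithZero.log (v.valuation (realField R) (b : realField R)))))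
    (q : (realField R)ˣ) (hq : (q : realField R) = ℓ) {k : ℕ} (hk : Even k) :
    (QuotientGroup.mk q : cmNormResidueGroup R) ≠ splitDiscriminantClassCM R k ↔
      ∃ v : HeightOneSpectrum (𝓞 (realField R)), (2 : 𝓞 (realField R)) ∉ v.asIdeal ∧ b ∉ v.asIdeal ∧
        ¬ IsSquare (Ideal.Quotient.mk v.asIdeal b) ∧
          Odd (WithZero.log (v.valuation (realField R) (ℓ : realField R))) := by
  rw [Ne, mk_eq_splitDiscriminantClassCM_iff_badPlaces_eq_empty q hk, hq, ← badPlaces_natCast_nonempty_iff hR hfac huniq hℓ hb,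
    Set.nonempty_iff_ne_empty]

/-- **COROLLARY (radicand prime to every odd place: `b ∣ 2^∞`, e.g. `E = F(√-1)`, `F(√-2)`, `F(√2·unit)`)**: if the only
finite places dividing `b` are dyadic and `F` has at most one dyadic place, then for EVERY rational prime `ℓ`:
`[ℓ] ≠ [(-1)^k]` iff some `v ∤ 2` has `b` a non-square mod `v` and `ord_v ℓ` odd. [cite: Deligne1982HodgeCycles, §4 (1)
and Cor. 4.2] [cite: Omeara1963, §63B Example 63:12 and §71D Thm. 71:18] -/
theorem mk_natCast_ne_splitDiscriminantClassCM_iff_of_dyadic_radicand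
    (hR : ∀ s : ℂ, Polynomial.eval₂ (Int.castRingHom ℂ) s R = 0 → s.im = 0 ∧ s.re < 0)
    {c : realField R} {b : 𝓞 (realField R)} (hfac : AdjoinRoot.root (realPolyQ R) = c ^ 2 * (b : realField R))
    (huniq : ∀ v v' : HeightOneSpectrum (𝓞 (realField R)),
      (2 : 𝓞 (realField R)) ∈ v.asIdeal → (2 : 𝓞 (realField R)) ∈ v'.asIdeal → v = v')
    (hb2 : ∀ v : HeightOneSpectrum (𝓞 (realField R)), b ∈ v.asIdeal → (2 : 𝓞 (realField R)) ∈ v.asIdeal)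
    {ℓ : ℕ} (hℓ : ℓ.Prime) (q : (realField R)ˣ) (hq : (q : realField R) = ℓ) {k : ℕ} (hk : Even k) :
    (QuotientGroup.mk q : cmNormResidueGroup R) ≠ splitDiscriminantClassCM R k ↔
      ∃ v : HeightOneSpectrum (𝓞 (realField R)), (2 : 𝓞 (realField R)) ∉ v.asIdeal ∧
        ¬ IsSquare (Ideal.Quotient.mk v.asIdeal b) ∧
          Odd (WithZero.log (v.valuation (realField R) (ℓ : realField R))) := by
  rw [mk_natCast_ne_splitDiscriminantClassCM_iff hR hfac huniq hℓ (fun v h2 hbv ↦ absurd (hb2 v hbv) h2) q hq hk]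
  constructor
  · rintro ⟨v, h2, -, hns, hodd⟩; exact ⟨v, h2, hns, hodd⟩
  · rintro ⟨v, h2, hns, hodd⟩; exact ⟨v, h2, fun hbv ↦ h2 (hb2 v hbv), hns, hodd⟩

end Summit.HodgeConjecture.HodgeConjecture.Ring2.WeilCoverageCM

end
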